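import Mathlib.Data.Finset.Card
import Mathlib.Data.Fintype.Basic
import Mathlib.Algebra.Order.BigOperators.Group.Finset
import Literature.Computability.Complexity.NegationElimination
import HarnessLib

/-!
# The monotone switching lemma and the lower-bounds criterion (Jukna 2012, §9.3–9.4)

Everything in this file is PROVED. It formalizes, for straight-line programs over the monotone
basis with constants `{∧₂, ∨₂, 0, 1}` (`monotoneBasis01`, `NegationElimination.lean`), the
"finite limit" / CNF–DNF approximation method of Jukna (1999), Berg–Ulfberg (1999) and
Harnik–Raz (2000) as presented in Jukna's book:

* `EvalCNF F x`, `EvalDNF F x` — a monotone CNF/DNF is a finite family of finite sets of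
  variables (clauses / monomials); `SatClause`, `SatTerm`. (Design: monotone formulas only, with
  clauses handled as *sets* — transversals, exact widths, cardinalities of correcting families —
  so they are `Finset (Finset ι)` rather than the signed-literal lists `CNF ν` of `CNF.lean`,
  which serve SAT and proof complexity.)
* `exists_transversal_tree` — the "transversal tree" of a family of sets (Jukna 2012, proof of
  Lemma 9.15): for a family of sets of size `≤ w`, depth `k`, the leaves (sets of size `< k`
  hitting every member) and the depth-`k` frontier (at most `w ^ k` sets of size exactly `k`)
  such that every hitting set contains a leaf or a frontier set.
* `monotoneSwitching_cnf`, `monotoneSwitching_dnf` — **Monotone Switching Lemma** (Jukna 2012,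
  Lemma 9.15, (9.2) and its dual (9.3)): an `(s-1)`-CNF has an `(r-1)`-DNF `f_dnf` and an
  exact `r`-DNF `D`, `|D| ≤ (s-1)^r`, with `f_dnf ≤ f_cnf ≤ f_dnf ∨ D`; dually for DNFs.
* `lowerBoundsCriterion` — **Theorem 9.17** (every function computed by a monotone circuit of
  size `t` is `t`-simple, Definition 9.16), in straight-line form: for a program with `t` gates
  over `{∧₂, ∨₂, 0, 1}` and any output wire computing `f`, and any `2 ≤ r, s`, there are an exact
  `s`-CNF `C` with `|C| ≤ t (r-1)^s`, an exact `r`-DNF `D` with `|D| ≤ t (s-1)^r` and a set `I`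
  of at most `s - 1` variables such that `C ≤ f` or `f ≤ D ∨ ⋁_{i ∈ I} x_i`;
  `Circuit.lowerBoundsCriterion` is the circuit form.

These serve the Amano–Maruoka fact (`AmanoMaruoka.lean`): the criterion is applied to the
NOT-free prefix feeding the first NOT gate of a `{∧₂, ∨₂, ¬}`-circuit for CLIQUE.

## References

* S. Jukna, *Boolean Function Complexity: Advances and Frontiers*, Springer (2012), §9.3
  (Lemma 9.15, p. 257) and §9.4 (Definition 9.16, Theorem 9.17, pp. 258–260) [Jukna2012].
-/

namespace Literature.Computability.Complexity

open Finset GateList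

variable {ι : Type*}

/-! ### Monotone CNFs and DNFs as set families -/

/-- The monotone clause `⋁_{i ∈ S} x_i` is satisfied by `x` (Jukna 2012, §9.3). [cite: Jukna2012, §9.3] -/
def SatClause (S : Finset ι) (x : ι → Bool) : Prop := ∃ i ∈ S, x i = true

/-- The monotone monomial `⋀_{i ∈ R} x_i` is satisfied by `x` (Jukna 2012, §9.3). [cite: Jukna2012, §9.3] -/
def SatTerm (R : Finset ι) (x : ι → Bool) : Prop := ∀ i ∈ R, x i = true

/-- Value of the monotone CNF with clause family `F` (an AND of ORs of variables; the empty
family is the constant `1`, a family containing the empty clause is `0`) (Jukna 2012, §9.3).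
[cite: Jukna2012, §9.3] -/
def EvalCNF (F : Finset (Finset ι)) (x : ι → Bool) : Prop := ∀ S ∈ F, SatClause S x

/-- Value of the monotone DNF with monomial family `F` (an OR of ANDs of variables; the empty
family is `0`, a family containing the empty monomial is `1`) (Jukna 2012, §9.3).
[cite: Jukna2012, §9.3] -/
def EvalDNF (F : Finset (Finset ι)) (x : ι → Bool) : Prop := ∃ R ∈ F, SatTerm R x

section Basic

variable {F G : Finset (Finset ι)} {x y : ι → Bool}

/-- Bigger clause families are harder to satisfy. [folklore] -/
theorem EvalCNF.anti (h : EvalCNF G x) (hFG : F ⊆ G) : EvalCNF F x := fun S hS => h S (hFG hS)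

/-- Bigger monomial families are easier to satisfy. [folklore] -/
theorem EvalDNF.mono (h : EvalDNF F x) (hFG : F ⊆ G) : EvalDNF G x := by
  obtain ⟨R, hR, h⟩ := h
  exact ⟨R, hFG hR, h⟩

/-- Monotone CNFs are monotone in the input. [folklore] -/
theorem EvalCNF.of_le (h : EvalCNF F x) (hxy : x ≤ y) : EvalCNF F y := fun S hS => by
  obtain ⟨i, hi, hx⟩ := h S hS
  exact ⟨i, hi, Bool.le_iff_imp.1 (hxy i) hx⟩

/-- Monotone DNFs are monotone in the input. [folklore] -/
theorem EvalDNF.of_le (h : EvalDNF F x) (hxy : x ≤ y) : EvalDNF F y := by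
  obtain ⟨R, hR, h⟩ := h
  exact ⟨R, hR, fun i hi => Bool.le_iff_imp.1 (hxy i) (h i hi)⟩

/-- The CNF of a union is the conjunction (definitional bookkeeping). [folklore] -/
theorem evalCNF_union [DecidableEq ι] : EvalCNF (F ∪ G) x ↔ EvalCNF F x ∧ EvalCNF G x := by
  simp only [EvalCNF, Finset.mem_union, or_imp, forall_and]

/-- The DNF of a union is the disjunction (definitional bookkeeping). [folklore] -/
theorem evalDNF_union [DecidableEq ι] : EvalDNF (F ∪ G) x ↔ EvalDNF F x ∨ EvalDNF G x := by
  simp only [EvalDNF, Finset.mem_union, or_and_right, exists_or]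

/-- The empty CNF is the constant `1`. [folklore] -/
@[simp] theorem evalCNF_empty : EvalCNF (∅ : Finset (Finset ι)) x := fun S hS => by simp at hS

/-- The empty DNF is the constant `0`. [folklore] -/
@[simp] theorem not_evalDNF_empty : ¬ EvalDNF (∅ : Finset (Finset ι)) x := by
  rintro ⟨R, hR, -⟩; simp at hR

/-- The DNF `{∅}` (empty monomial) is the constant `1`. [folklore] -/
theorem evalDNF_singleton_empty : EvalDNF ({∅} : Finset (Finset ι)) x :=
  ⟨∅, Finset.mem_singleton_self _, fun i hi => by simp at hi⟩

/-- The CNF `{∅}` (empty clause) is the constant `0`. [folklore] -/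
theorem not_evalCNF_singleton_empty : ¬ EvalCNF ({∅} : Finset (Finset ι)) x := fun h => by
  obtain ⟨i, hi, -⟩ := h ∅ (Finset.mem_singleton_self _)
  simp at hi

/-- The one-variable CNF `{{i}}` is the variable `x_i`. [folklore] -/
theorem evalCNF_singleton_singleton (i : ι) :
    EvalCNF ({{i}} : Finset (Finset ι)) x ↔ x i = true := by
  simp [EvalCNF, SatClause]

/-- The one-variable DNF `{{i}}` is the variable `x_i`. [folklore] -/
theorem evalDNF_singleton_singleton (i : ι) :
    EvalDNF ({{i}} : Finset (Finset ι)) x ↔ x i = true := by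
  simp [EvalDNF, SatTerm]

end Basic

/-! ### The transversal tree (Jukna 2012, proof of Lemma 9.15) -/

/-- **Transversal tree** of a set family `qs` with members of size `≤ w`, grown from the node `p`
to depth `k` (Jukna 2012, proof of Lemma 9.15): a node `p` hitting every member is a leaf;
otherwise it branches over the elements of some member it misses. `Lv` collects the leaves of
depth `< k` below `p` (each hits every member and has fewer than `#p + k` elements), `Fr` the
nodes at depth exactly `k` (exactly `#p + k` elements, at most `w ^ k` of them, since every node
has fan-out `≤ w`), and every set `S ⊇ p` hitting all members contains a leaf or a frontier
node (walk down the tree inside `S`). [cite: Jukna2012, Lemma 9.15] -/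
theorem exists_transversal_tree [DecidableEq ι] (qs : Finset (Finset ι)) (w : ℕ)
    (hqs : ∀ q ∈ qs, #q ≤ w) (k : ℕ) :
    ∀ p : Finset ι, ∃ Lv Fr : Finset (Finset ι),
      (∀ L ∈ Lv, #L + 1 ≤ #p + k ∧ p ⊆ L ∧ ∀ q ∈ qs, (L ∩ q).Nonempty) ∧
      (∀ P ∈ Fr, #P = #p + k ∧ p ⊆ P) ∧ #Fr ≤ w ^ k ∧
      ∀ S : Finset ι, p ⊆ S → (∀ q ∈ qs, (S ∩ q).Nonempty) →
        (∃ L ∈ Lv, L ⊆ S) ∨ (∃ P ∈ Fr, P ⊆ S) := by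
  induction k with
  | zero =>
    intro p
    refine ⟨∅, {p}, by simp, by simp, by simp, fun S hpS _ => Or.inr ⟨p, by simp, hpS⟩⟩
  | succ k ih =>
    intro p
    by_cases hall : ∀ q ∈ qs, (p ∩ q).Nonempty
    · refine ⟨{p}, ∅, ?_, by simp, by simp, fun S hpS _ => Or.inl ⟨p, by simp, hpS⟩⟩
      simp only [Finset.mem_singleton, forall_eq]
      exact ⟨by omega, Finset.Subset.rfl, hall⟩
    · push Not at hall
      obtain ⟨q, hq, hpq⟩ := hall
      have hvp : ∀ v ∈ q, v ∉ p := fun v hv hvp' =>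
        Finset.notMem_empty v (hpq ▸ Finset.mem_inter.2 ⟨hvp', hv⟩)
      choose Lv Fr hLv hFr hcard hcov using fun v : ι => ih (insert v p)
      refine ⟨q.biUnion Lv, q.biUnion Fr, ?_, ?_, ?_, ?_⟩
      · intro L hL
        obtain ⟨v, hv, hL⟩ := Finset.mem_biUnion.1 hL
        obtain ⟨h1, h2, h3⟩ := hLv v L hL
        rw [Finset.card_insert_of_notMem (hvp v hv)] at h1
        exact ⟨by omega, (Finset.subset_insert v p).trans h2, h3⟩
      · intro P hP
        obtain ⟨v, hv, hP⟩ := Finset.mem_biUnion.1 hP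
        obtain ⟨h1, h2⟩ := hFr v P hP
        rw [Finset.card_insert_of_notMem (hvp v hv)] at h1
        exact ⟨by omega, (Finset.subset_insert v p).trans h2⟩
      · calc #(q.biUnion Fr) ≤ #q * w ^ k :=
              Finset.card_biUnion_le_card_mul q Fr (w ^ k) fun v _ => hcard v
          _ ≤ w * w ^ k := Nat.mul_le_mul_right _ (hqs q hq)
          _ = w ^ (k + 1) := by rw [pow_succ']
      · intro S hpS hS
        obtain ⟨v, hv⟩ := hS q hq
        rw [Finset.mem_inter] at hv
        have hins : insert v p ⊆ S := Finset.insert_subset hv.1 hpS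
        rcases hcov v S hins hS with ⟨L, hL, hLS⟩ | ⟨P, hP, hPS⟩
        · exact Or.inl ⟨L, Finset.mem_biUnion.2 ⟨v, hv.2, hL⟩, hLS⟩
        · exact Or.inr ⟨P, Finset.mem_biUnion.2 ⟨v, hv.2, hP⟩, hPS⟩

/-! ### The Monotone Switching Lemma (Jukna 2012, Lemma 9.15) -/

/-- **Monotone Switching Lemma, CNF to DNF** (Jukna 2012, Lemma 9.15, (9.2)): for every
`(s-1)`-CNF `f_cnf` there is an `(r-1)`-DNF `f_dnf` and an exact `r`-DNF `D` with at most
`(s-1)^r` monomials such that `f_dnf ≤ f_cnf ≤ f_dnf ∨ D`. (Proof: leaves and depth-`r`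
frontier of the transversal tree, `exists_transversal_tree`.) [cite: Jukna2012, Lemma 9.15] -/
theorem monotoneSwitching_cnf [Fintype ι] [DecidableEq ι] (cnf : Finset (Finset ι)) (s r : ℕ)
    (hw : ∀ S ∈ cnf, #S ≤ s - 1) :
    ∃ dnf D : Finset (Finset ι), (∀ R ∈ dnf, #R ≤ r - 1) ∧ (∀ P ∈ D, #P = r) ∧
      #D ≤ (s - 1) ^ r ∧ (∀ x, EvalDNF dnf x → EvalCNF cnf x) ∧
      (∀ x, EvalCNF cnf x → EvalDNF dnf x ∨ EvalDNF D x) := by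
  obtain ⟨Lv, Fr, hLv, hFr, hcard, hcov⟩ := exists_transversal_tree cnf (s - 1) hw r ∅
  refine ⟨Lv, Fr, fun R hR => ?_, fun P hP => by simpa using (hFr P hP).1, hcard,
    fun x hx => ?_, fun x hx => ?_⟩
  · have := (hLv R hR).1
    simp only [Finset.card_empty, zero_add] at this
    omega
  · obtain ⟨R, hR, hRx⟩ := hx
    intro S hS
    obtain ⟨i, hi⟩ := (hLv R hR).2.2 S hS
    rw [Finset.mem_inter] at hi
    exact ⟨i, hi.2, hRx i hi.1⟩
  · have hpierce : ∀ q ∈ cnf, ((univ.filter fun i => x i = true) ∩ q).Nonempty := by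
      intro q hq
      obtain ⟨i, hi, hxi⟩ := hx q hq
      exact ⟨i, Finset.mem_inter.2 ⟨Finset.mem_filter.2 ⟨Finset.mem_univ _, hxi⟩, hi⟩⟩
    rcases hcov _ (Finset.empty_subset _) hpierce with ⟨L, hL, hLS⟩ | ⟨P, hP, hPS⟩
    · exact Or.inl ⟨L, hL, fun i hi => (Finset.mem_filter.1 (hLS hi)).2⟩
    · exact Or.inr ⟨P, hP, fun i hi => (Finset.mem_filter.1 (hPS hi)).2⟩

/-- **Monotone Switching Lemma, DNF to CNF** (Jukna 2012, Lemma 9.15, (9.3), the dual form):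
for every `(r-1)`-DNF `f_dnf` there is an `(s-1)`-CNF `f_cnf` and an exact `s`-CNF `C` with at
most `(r-1)^s` clauses such that `f_cnf ∧ C ≤ f_dnf ≤ f_cnf`. (Proof: the transversal tree of
the monomials, read on the set of false coordinates.) [cite: Jukna2012, Lemma 9.15] -/
theorem monotoneSwitching_dnf [Fintype ι] [DecidableEq ι] (dnf : Finset (Finset ι)) (r s : ℕ)
    (hw : ∀ R ∈ dnf, #R ≤ r - 1) :
    ∃ cnf C : Finset (Finset ι), (∀ S ∈ cnf, #S ≤ s - 1) ∧ (∀ P ∈ C, #P = s) ∧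
      #C ≤ (r - 1) ^ s ∧ (∀ x, EvalDNF dnf x → EvalCNF cnf x) ∧
      (∀ x, EvalCNF cnf x → EvalCNF C x → EvalDNF dnf x) := by
  obtain ⟨Lv, Fr, hLv, hFr, hcard, hcov⟩ := exists_transversal_tree dnf (r - 1) hw s ∅
  refine ⟨Lv, Fr, fun S hS => ?_, fun P hP => by simpa using (hFr P hP).1, hcard,
    fun x hx => ?_, fun x hcnf hC => ?_⟩
  · have := (hLv S hS).1
    simp only [Finset.card_empty, zero_add] at this
    omega
  · obtain ⟨R, hR, hRx⟩ := hx
    intro L hL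
    obtain ⟨i, hi⟩ := (hLv L hL).2.2 R hR
    rw [Finset.mem_inter] at hi
    exact ⟨i, hi.1, hRx i hi.2⟩
  · by_contra hno
    have hpierce : ∀ q ∈ dnf, ((univ.filter fun i => x i = false) ∩ q).Nonempty := by
      intro q hq
      by_contra hne
      refine hno ⟨q, hq, fun i hi => ?_⟩
      cases hxi : x i
      · exact absurd ⟨i, Finset.mem_inter.2 ⟨Finset.mem_filter.2 ⟨Finset.mem_univ _, hxi⟩, hi⟩⟩
          hne
      · rfl
    rcases hcov _ (Finset.empty_subset _) hpierce with ⟨L, hL, hLS⟩ | ⟨P, hP, hPS⟩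
    · obtain ⟨i, hi, hxi⟩ := hcnf L hL
      have := (Finset.mem_filter.1 (hLS hi)).2
      rw [hxi] at this
      exact Bool.noConfusion this
    · obtain ⟨i, hi, hxi⟩ := hC P hP
      have := (Finset.mem_filter.1 (hPS hi)).2
      rw [hxi] at this
      exact Bool.noConfusion this

/-! ### Approximators along a straight-line program (Jukna 2012, proof of Theorem 9.17) -/

/-- The invariant of the pair `(f_cnf, f_dnf)` approximating a wire computing `v`, relative
to the current global "correcting" families `C` (exact `s`-clauses) and `D` (exact `r`-monomials)
(Jukna 2012, proof of Thm 9.17): widths, `f_dnf ≤ f_cnf`, `C ∧ f_cnf ≤ v` and `v ≤ f_dnf ∨ D`.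
[cite: Jukna2012, Thm. 9.17] -/
structure ApproxInv (r s : ℕ) (C D cnf dnf : Finset (Finset ι)) (v : (ι → Bool) → Bool) :
    Prop where
  /-- clauses have fewer than `s` variables -/
  width_cnf : ∀ S ∈ cnf, #S ≤ s - 1
  /-- monomials have fewer than `r` variables -/
  width_dnf : ∀ R ∈ dnf, #R ≤ r - 1
  /-- the right approximator is below the left one -/
  dnf_le_cnf : ∀ x, EvalDNF dnf x → EvalCNF cnf x
  /-- `C ∧ f_cnf ≤ v` -/
  lower : ∀ x, EvalCNF C x → EvalCNF cnf x → v x = true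
  /-- `v ≤ f_dnf ∨ D` -/
  upper : ∀ x, v x = true → EvalDNF dnf x ∨ EvalDNF D x

namespace ApproxInv

variable {r s : ℕ} {C D C' D' cnf dnf : Finset (Finset ι)} {v v' : (ι → Bool) → Bool}

/-- Enlarging the correcting families preserves the invariant. [folklore] -/
theorem mono (h : ApproxInv r s C D cnf dnf v) (hC : C ⊆ C') (hD : D ⊆ D') :
    ApproxInv r s C' D' cnf dnf v where
  width_cnf := h.width_cnf
  width_dnf := h.width_dnf
  dnf_le_cnf := h.dnf_le_cnf
  lower x hx hcnf := h.lower x (hx.anti hC) hcnf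
  upper x hx := (h.upper x hx).imp_right fun hd => hd.mono hD

/-- Extensionality in the approximated function. [folklore] -/
theorem congr (h : ApproxInv r s C D cnf dnf v) (hv : ∀ x, v x = v' x) :
    ApproxInv r s C D cnf dnf v' where
  width_cnf := h.width_cnf
  width_dnf := h.width_dnf
  dnf_le_cnf := h.dnf_le_cnf
  lower x hx hcnf := (hv x) ▸ h.lower x hx hcnf
  upper x hx := h.upper x ((hv x).symm ▸ hx)

/-- Input variables are approximated exactly by `({{i}}, {{i}})` (Jukna 2012, Thm 9.17,
Case 1). [cite: Jukna2012, Thm. 9.17] -/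
theorem input (hr : 2 ≤ r) (hs : 2 ≤ s) (i : ι) :
    ApproxInv r s C D {{i}} {{i}} (fun x : ι → Bool => x i) where
  width_cnf S hS := by rw [Finset.mem_singleton.1 hS, Finset.card_singleton]; omega
  width_dnf R hR := by rw [Finset.mem_singleton.1 hR, Finset.card_singleton]; omega
  dnf_le_cnf x hx := (evalCNF_singleton_singleton i).2 ((evalDNF_singleton_singleton i).1 hx)
  lower x _ hx := (evalCNF_singleton_singleton i).1 hx
  upper x hx := Or.inl ((evalDNF_singleton_singleton i).2 hx)

/-- The constant `1` is approximated exactly by `(∅, {∅})`. [folklore] -/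
theorem const_true : ApproxInv r s C D ∅ {∅} (fun _ : ι → Bool => true) where
  width_cnf S hS := by simp at hS
  width_dnf R hR := by rw [Finset.mem_singleton.1 hR]; simp
  dnf_le_cnf x _ := evalCNF_empty
  lower _ _ _ := rfl
  upper x _ := Or.inl evalDNF_singleton_empty

/-- The constant `0` is approximated exactly by `({∅}, ∅)`. [folklore] -/
theorem const_false : ApproxInv r s C D {∅} ∅ (fun _ : ι → Bool => false) where
  width_cnf S hS := by rw [Finset.mem_singleton.1 hS]; simp
  width_dnf R hR := by simp at hR
  dnf_le_cnf x hx := absurd hx not_evalDNF_empty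
  lower x _ hx := absurd hx not_evalCNF_singleton_empty
  upper x hx := absurd hx Bool.false_ne_true

/-- **AND gates** (Jukna 2012, Thm 9.17, Case 2): the left approximator is the conjunction
(union of clause families, no new errors); the right one is obtained by switching, its new
errors corrected by an exact `r`-DNF of size `≤ (s-1)^r` added to `D`. [cite: Jukna2012, Thm. 9.17] -/
theorem and_gate [Fintype ι] [DecidableEq ι] {cu du cv dv : Finset (Finset ι)}
    {u w : (ι → Bool) → Bool} (hu : ApproxInv r s C D cu du u) (hw : ApproxInv r s C D cv dv w) :
    ∃ dnf Df : Finset (Finset ι), (∀ P ∈ Df, #P = r) ∧ #Df ≤ (s - 1) ^ r ∧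
      ApproxInv r s C (D ∪ Df) (cu ∪ cv) dnf (fun x => u x && w x) := by
  have hwidth : ∀ S ∈ cu ∪ cv, #S ≤ s - 1 := fun S hS => by
    rcases Finset.mem_union.1 hS with hS | hS
    · exact hu.width_cnf S hS
    · exact hw.width_cnf S hS
  obtain ⟨dnf, Df, h1, h2, h3, h4, h5⟩ := monotoneSwitching_cnf (cu ∪ cv) s r hwidth
  refine ⟨dnf, Df, h2, h3, ⟨hwidth, h1, h4, fun x hx hcnf => ?_, fun x hx => ?_⟩⟩
  · rw [evalCNF_union] at hcnf
    rw [hu.lower x hx hcnf.1, hw.lower x hx hcnf.2]; rfl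
  · rw [Bool.and_eq_true] at hx
    rcases hu.upper x hx.1 with hdu | hD
    · rcases hw.upper x hx.2 with hdv | hD
      · have hc : EvalCNF (cu ∪ cv) x := evalCNF_union.2 ⟨hu.dnf_le_cnf x hdu, hw.dnf_le_cnf x hdv⟩
        rcases h5 x hc with h | h
        · exact Or.inl h
        · exact Or.inr (h.mono Finset.subset_union_right)
      · exact Or.inr (hD.mono Finset.subset_union_left)
    · exact Or.inr (hD.mono Finset.subset_union_left)

/-- **OR gates** (Jukna 2012, Thm 9.17, Case 3, dual to Case 2): the right approximator is the
disjunction; the left one is obtained by switching, its new errors corrected by an exact `s`-CNF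
of size `≤ (r-1)^s` added to `C`. [cite: Jukna2012, Thm. 9.17] -/
theorem or_gate [Fintype ι] [DecidableEq ι] {cu du cv dv : Finset (Finset ι)}
    {u w : (ι → Bool) → Bool} (hu : ApproxInv r s C D cu du u) (hw : ApproxInv r s C D cv dv w) :
    ∃ cnf Cf : Finset (Finset ι), (∀ P ∈ Cf, #P = s) ∧ #Cf ≤ (r - 1) ^ s ∧
      ApproxInv r s (C ∪ Cf) D cnf (du ∪ dv) (fun x => u x || w x) := by
  have hwidth : ∀ R ∈ du ∪ dv, #R ≤ r - 1 := fun R hR => by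
    rcases Finset.mem_union.1 hR with hR | hR
    · exact hu.width_dnf R hR
    · exact hw.width_dnf R hR
  obtain ⟨cnf, Cf, h1, h2, h3, h4, h5⟩ := monotoneSwitching_dnf (du ∪ dv) r s hwidth
  refine ⟨cnf, Cf, h2, h3, ⟨h1, hwidth, h4, fun x hx hcnf => ?_, fun x hx => ?_⟩⟩
  · rw [evalCNF_union] at hx
    have hd : EvalDNF (du ∪ dv) x := h5 x hcnf hx.2
    rcases evalDNF_union.1 hd with hd | hd
    · rw [hu.lower x hx.1 (hu.dnf_le_cnf x hd)]; rfl
    · rw [hw.lower x hx.1 (hw.dnf_le_cnf x hd)]; simp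
  · rw [Bool.or_eq_true] at hx
    rcases hx with hx | hx
    · rcases hu.upper x hx with h | h
      · exact Or.inl (h.mono Finset.subset_union_left)
      · exact Or.inr h
    · rcases hw.upper x hx with h | h
      · exact Or.inl (h.mono Finset.subset_union_right)
      · exact Or.inr h

end ApproxInv

namespace GateList

/-- **Approximating a whole program** (Jukna 2012, proof of Thm 9.17): along a well-formed
program over `{∧₂, ∨₂, 0, 1}` every wire receives an approximator pair satisfying `ApproxInv`
relative to global correcting families `C` (exact `s`-clauses, at most `(r-1)^s` per gate) and
`D` (exact `r`-monomials, at most `(s-1)^r` per gate). [cite: Jukna2012, Thm. 9.17] -/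
theorem exists_approximators [Fintype ι] [DecidableEq ι] {r s : ℕ} (hr : 2 ≤ r) (hs : 2 ≤ s) :
    ∀ gs : List (Gate ι), WF gs → (∀ g ∈ gs, g.fn ∈ monotoneBasis01) →
      ∃ (ap : ι ⊕ ℕ → Finset (Finset ι) × Finset (Finset ι)) (C D : Finset (Finset ι)),
        (∀ P ∈ C, #P = s) ∧ (∀ P ∈ D, #P = r) ∧
        #C ≤ gs.length * (r - 1) ^ s ∧ #D ≤ gs.length * (s - 1) ^ r ∧
        ∀ w : ι ⊕ ℕ, OutOK gs.length w →
          ApproxInv r s C D (ap w).1 (ap w).2 (fun x => wireOf x (vals gs x) w) := by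
  intro gs
  induction gs using List.reverseRecOn with
  | nil =>
    intro _ _
    refine ⟨fun w => match w with
      | .inl i => ({{i}}, {{i}})
      | .inr _ => (∅, ∅), ∅, ∅, by simp, by simp, by simp, by simp, fun w hw => ?_⟩
    rcases w with i | m
    · exact ApproxInv.input hr hs i
    · exact absurd (hw m rfl) (by simp)
  | append_singleton gs g ih =>
    intro hwf hB
    obtain ⟨ap, C, D, hC, hD, hcC, hcD, hinv⟩ :=
      ih hwf.of_append_left fun g hg => hB g (List.mem_append_left _ hg)
    have hgOK : GateOK gs.length g := hwf.gateOK_mid (post := [])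
    have hgB : g.fn ∈ monotoneBasis01 := hB g (by simp)
    -- old wires keep their values and invariants
    have hold : ∀ (C' D' : Finset (Finset ι)), C ⊆ C' → D ⊆ D' → ∀ w : ι ⊕ ℕ,
        OutOK gs.length w →
        ApproxInv r s C' D' (ap w).1 (ap w).2 (fun x => wireOf x (vals (gs ++ [g]) x) w) :=
      fun C' D' hC' hD' w hw =>
        ((hinv w hw).mono hC' hD').congr fun x => (wireOf_vals_append gs [g] x w hw).symm
    -- the value of the new gate
    have hnew : ∀ x, wireOf x (vals (gs ++ [g]) x) (.inr gs.length) =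
        g.op (fun a => wireOf x (vals gs x) (g.args a)) := fun x => by
      rw [wireOf_inr, show gs ++ [g] = gs ++ g :: [] from rfl, getD_vals_append_cons]
    -- how to assemble the conclusion from an approximator of the new gate
    have assemble : ∀ (C' D' : Finset (Finset ι)) (cn dn : Finset (Finset ι)),
        C ⊆ C' → D ⊆ D' → (∀ P ∈ C', #P = s) → (∀ P ∈ D', #P = r) →
        #C' ≤ (gs ++ [g]).length * (r - 1) ^ s → #D' ≤ (gs ++ [g]).length * (s - 1) ^ r →
        ApproxInv r s C' D' cn dn (fun x => wireOf x (vals (gs ++ [g]) x) (.inr gs.length)) →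
        ∃ (ap : ι ⊕ ℕ → Finset (Finset ι) × Finset (Finset ι)) (C D : Finset (Finset ι)),
          (∀ P ∈ C, #P = s) ∧ (∀ P ∈ D, #P = r) ∧
          #C ≤ (gs ++ [g]).length * (r - 1) ^ s ∧ #D ≤ (gs ++ [g]).length * (s - 1) ^ r ∧
          ∀ w : ι ⊕ ℕ, OutOK (gs ++ [g]).length w →
            ApproxInv r s C D (ap w).1 (ap w).2 (fun x => wireOf x (vals (gs ++ [g]) x) w) := by
      intro C' D' cn dn hCC' hDD' hC' hD' hcC' hcD' hnewinv
      refine ⟨fun w => if w = .inr gs.length then (cn, dn) else ap w, C', D', hC', hD', hcC',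
        hcD', fun w hw => ?_⟩
      by_cases hwn : w = .inr gs.length
      · subst hwn
        simpa using hnewinv
      · dsimp only
        rw [if_neg hwn]
        refine hold C' D' hCC' hDD' w fun m hm => ?_
        have h1 := hw m hm
        simp only [List.length_append, List.length_singleton] at h1
        have h2 : m ≠ gs.length := fun h => hwn (hm.trans (by rw [h]))
        omega
    have hlen : (gs ++ [g]).length = gs.length + 1 := by simp
    simp only [monotoneBasis01, monotoneBasis, Set.mem_insert_iff, Set.mem_singleton_iff] at hgB
    rcases hgB with hc | hc | hc | hc
    · -- constant `1`
      have hg := exists_eq_constGate_of_fn_eq hc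
      subst hg
      refine assemble C D ∅ {∅} Finset.Subset.rfl Finset.Subset.rfl hC hD
        (hcC.trans (Nat.mul_le_mul_right _ (by simp))) (hcD.trans (Nat.mul_le_mul_right _ (by simp)))
        (ApproxInv.const_true.congr fun x => ?_)
      rw [hnew]; rfl
    · -- constant `0`
      have hg := exists_eq_constGate_of_fn_eq hc
      subst hg
      refine assemble C D {∅} ∅ Finset.Subset.rfl Finset.Subset.rfl hC hD
        (hcC.trans (Nat.mul_le_mul_right _ (by simp))) (hcD.trans (Nat.mul_le_mul_right _ (by simp)))
        (ApproxInv.const_false.congr fun x => ?_)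
      rw [hnew]; rfl
    · -- AND gate
      obtain ⟨u, v, rfl⟩ := exists_eq_andGate_of_fn_eq hc
      have hu : OutOK gs.length u := fun m hm => hgOK (0 : Fin 2) m hm
      have hv : OutOK gs.length v := fun m hm => hgOK (1 : Fin 2) m hm
      obtain ⟨dn, Df, hDf, hcDf, hnewinv⟩ := ApproxInv.and_gate (hinv u hu) (hinv v hv)
      have hcD' : #(D ∪ Df) ≤ (gs.length + 1) * (s - 1) ^ r :=
        calc #(D ∪ Df) ≤ #D + #Df := Finset.card_union_le _ _
          _ ≤ gs.length * (s - 1) ^ r + (s - 1) ^ r := Nat.add_le_add hcD hcDf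
          _ = (gs.length + 1) * (s - 1) ^ r := by ring
      refine assemble C (D ∪ Df) _ dn Finset.Subset.rfl Finset.subset_union_left hC
        (fun P hP => ?_) (hcC.trans (Nat.mul_le_mul_right _ (by simp))) (by rw [hlen]; exact hcD')
        (hnewinv.congr fun x => ?_)
      · rcases Finset.mem_union.1 hP with hP | hP
        · exact hD P hP
        · exact hDf P hP
      · rw [hnew, andGate_op]
    · -- OR gate
      obtain ⟨u, v, rfl⟩ := exists_eq_orGate_of_fn_eq hc
      have hu : OutOK gs.length u := fun m hm => hgOK (0 : Fin 2) m hm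
      have hv : OutOK gs.length v := fun m hm => hgOK (1 : Fin 2) m hm
      obtain ⟨cn, Cf, hCf, hcCf, hnewinv⟩ := ApproxInv.or_gate (hinv u hu) (hinv v hv)
      have hcC' : #(C ∪ Cf) ≤ (gs.length + 1) * (r - 1) ^ s :=
        calc #(C ∪ Cf) ≤ #C + #Cf := Finset.card_union_le _ _
          _ ≤ gs.length * (r - 1) ^ s + (r - 1) ^ s := Nat.add_le_add hcC hcCf
          _ = (gs.length + 1) * (r - 1) ^ s := by ring
      refine assemble (C ∪ Cf) D cn _ Finset.subset_union_left Finset.Subset.rfl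
        (fun P hP => ?_) hD (by rw [hlen]; exact hcC') (hcD.trans (Nat.mul_le_mul_right _ (by simp)))
        (hnewinv.congr fun x => ?_)
      · rcases Finset.mem_union.1 hP with hP | hP
        · exact hC P hP
        · exact hCf P hP
      · rw [hnew, orGate_op]

/-- **The lower-bounds criterion, straight-line form** (Jukna 2012, Definition 9.16 and
Theorem 9.17: a function computed by a monotone circuit with `t` gates is `t`-simple). Let a
well-formed program with `t` gates over `{∧₂, ∨₂, 0, 1}` be given, an output wire computing
`f`, and integers `r, s ≥ 2`. Then there are an exact `s`-CNF `C` with `|C| ≤ t (r-1)^s`, an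
exact `r`-DNF `D` with `|D| ≤ t (s-1)^r`, and a set `I` of at most `s - 1` variables, such that
`C ≤ f` or `f ≤ D ∨ ⋁_{i ∈ I} x_i`. [cite: Jukna2012, Thm. 9.17] -/
theorem lowerBoundsCriterion [Fintype ι] [DecidableEq ι] (gs : List (Gate ι)) (hwf : WF gs)
    (hB : ∀ g ∈ gs, g.fn ∈ monotoneBasis01) (o : ι ⊕ ℕ) (ho : OutOK gs.length o)
    {r s : ℕ} (hr : 2 ≤ r) (hs : 2 ≤ s) :
    ∃ (C D : Finset (Finset ι)) (I : Finset ι),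
      (∀ P ∈ C, #P = s) ∧ (∀ P ∈ D, #P = r) ∧ #C ≤ gs.length * (r - 1) ^ s ∧
      #D ≤ gs.length * (s - 1) ^ r ∧ #I ≤ s - 1 ∧
      ((∀ x, EvalCNF C x → wireOf x (vals gs x) o = true) ∨
        (∀ x, wireOf x (vals gs x) o = true → SatClause I x ∨ EvalDNF D x)) := by
  obtain ⟨ap, C, D, hC, hD, hcC, hcD, hinv⟩ := exists_approximators hr hs gs hwf hB
  have h := hinv o ho
  rcases ((ap o).1).eq_empty_or_nonempty with he | ⟨S, hS⟩
  · refine ⟨C, D, ∅, hC, hD, hcC, hcD, by simp, Or.inl fun x hx => h.lower x hx ?_⟩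
    rw [he]
    exact evalCNF_empty
  · refine ⟨C, D, S, hC, hD, hcC, hcD, h.width_cnf S hS, Or.inr fun x hx => ?_⟩
    rcases h.upper x hx with hd | hd
    · exact Or.inl (h.dnf_le_cnf x hd S hS)
    · exact Or.inr hd

end GateList

/-- **The lower-bounds criterion for circuits** (Jukna 2012, Theorem 9.17): a Boolean function
`f` computed by a circuit with `t` gates over `{∧₂, ∨₂, 0, 1}` (in particular over the monotone
basis `{∧₂, ∨₂}`) is `t`-simple: for all `r, s ≥ 2` there are an exact `s`-CNF `C`,
`|C| ≤ t (r-1)^s`, an exact `r`-DNF `D`, `|D| ≤ t (s-1)^r`, and `I` with `|I| ≤ s - 1` such that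
`C ≤ f` or `f ≤ D ∨ ⋁_{i ∈ I} x_i`. [cite: Jukna2012, Thm. 9.17] -/
theorem Circuit.lowerBoundsCriterion [Fintype ι] [DecidableEq ι] (M : Circuit ι)
    (hM : M.IsOver monotoneBasis01) {f : (ι → Bool) → Bool} (hf : M.Computes f)
    {r s : ℕ} (hr : 2 ≤ r) (hs : 2 ≤ s) :
    ∃ (C D : Finset (Finset ι)) (I : Finset ι),
      (∀ P ∈ C, #P = s) ∧ (∀ P ∈ D, #P = r) ∧ #C ≤ M.size * (r - 1) ^ s ∧
      #D ≤ M.size * (s - 1) ^ r ∧ #I ≤ s - 1 ∧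
      ((∀ x, EvalCNF C x → f x = true) ∨ (∀ x, f x = true → SatClause I x ∨ EvalDNF D x)) := by
  obtain ⟨C, D, I, hC, hD, hcC, hcD, hI, h⟩ :=
    GateList.lowerBoundsCriterion M.gates (wf_gates M) hM M.output M.wf_output hr hs
  refine ⟨C, D, I, hC, hD, hcC, hcD, hI, ?_⟩
  simp only [← circuit_eval, hf _] at h
  exact h

/-- The criterion over the constant-free monotone basis `{∧₂, ∨₂}`. [cite: Jukna2012, Thm. 9.17] -/
theorem Circuit.lowerBoundsCriterion_monotone [Fintype ι] [DecidableEq ι] (M : Circuit ι)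
    (hM : M.IsOver monotoneBasis) {f : (ι → Bool) → Bool} (hf : M.Computes f)
    {r s : ℕ} (hr : 2 ≤ r) (hs : 2 ≤ s) :
    ∃ (C D : Finset (Finset ι)) (I : Finset ι),
      (∀ P ∈ C, #P = s) ∧ (∀ P ∈ D, #P = r) ∧ #C ≤ M.size * (r - 1) ^ s ∧
      #D ≤ M.size * (s - 1) ^ r ∧ #I ≤ s - 1 ∧
      ((∀ x, EvalCNF C x → f x = true) ∨ (∀ x, f x = true → SatClause I x ∨ EvalDNF D x)) :=
  M.lowerBoundsCriterion (hM.mono monotoneBasis_subset_monotoneBasis01) hf hr hs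

end Literature.Computability.Complexity
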